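import Summits.BirchSwinnertonDyer.BirchSwinnertonDyer.Theorems.PrintCf2RamifiedOffTYZBlockFreeRho
import HarnessLib

/-!
# Route `PrintCf2`, crux stmt-BirchSwinnertonDyer-20509 `RamifiedOffTYZOfFacts` — ★ THE BLOCK-FREE STRUCTURE THEOREM FOR C⁺: on the block-free family
# `C⁺(n) ⟺ depth_{A(ℍ′_n)/tors} P(n) = [X(h) ∈ 2ℚ^{×2}]` — the generator side ELIMINATED, the statement indexed by the descent class of the
# `A_n`-generator alone (cell `bsd-print-cf2`, LEAD of 20509 g18, line `offtyz-v7`, lineage cycle 19; fact-free, Theses-free, no `def`)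

HONEST FRAMING (crux 20509 = `𝔅_ram → WAllCornerFTwoRamifiedOffTYZProved`, DECIDING, OPEN AS A CLASS; C⁺ = `stub_offTYZ_levelTwoScriptLExact` = item
stmt-BirchSwinnertonDyer-23431: on the jump-one rank-one class `2 ∥ 𝓛(n)`; OPEN, equivalent to `BSD(E_n, 2)` there).  ASSEMBLY ONLY: TYZ §3 as displayed
(`D.Printed`: Thm. 3.5 main clause, integrality, Lemma 3.18), the compositum sentence (`D.CMPointCompositumPrinted`: on the block-free family
`Gal(ℍ′_n/ℚ)` is commutative) and GZK are HYPOTHESES, exactly as in the files assembled: g3's `ρ`-free dichotomy (`…LevelTwoRhoValve`), g16's visibility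
criterion (`…VisibleGenerator`, `…LowerHalfVisibleSeven`), and this seat's cycle-19 files `…GeneratorDepth{,RhoOne}` (`depth α_n ≤ 1`; `ρ = 1 ⟹
[Q₁] ≠ 0`), `…InvisibleGenerator` (`d(h) = 2 ⟹ [α_n] = 0`) and `…BlockFreeRho` (`ρ(n)` from `X(h)`).  Nothing is asserted; no named fact is introduced.

* `levelTwo_iff_depth_eq_one_of_X_eq_two_mul_sq` — `h = (2s², Y)` (the INVISIBLE special stratum): **C⁺ at `n` ⟺ `P(n) ∈ 2A(ℍ′_n) + tors ∧ P(n) ∉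
  4A(ℍ′_n) + tors`** (no `ρ`-hypothesis).
* `levelTwo_iff_not_twoDivisible_of_X_ne_two_mul_sq` — `X(h) ∉ 2ℚ^{×2}` (the strata `ρ = 1` and visible-special): **C⁺ at `n` ⟺ `P(n) ∉ 2A(ℍ′_n) +
  tors`** (no `ρ`-hypothesis).
* ★★★ `levelTwo_iff_depth_genusPoint_blockFree` — **THE STRUCTURE THEOREM**: square-free `n ≡ 7 (mod 8)` with no divisor `≡ 5 (mod 8)`,
  `ord_{s=1} L(E_n, s) = 1`, GZK, displays, `h = (X, Y)` ANY generator of `A_n(ℚ)` modulo torsion ⟹ (C⁺ at `n` ⟺ [`X ∈ 2ℚ^{×2}` and `P(n)` has depth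
  exactly `1`] or [`X ∉ 2ℚ^{×2}` and `P(n)` has depth `0`]).

What this buys the line (LEAD census, crux 20509): ONE by-name statement of everything the lineage proved about C⁺ on the block-free family; the open
content is the `2`-adic depth of TYZ's point `P(n)` (⟸ the genus period `Z(n)` modulo `4A`; the census instrument of g17/g18 measures it: `= [d(h) = 2]` at
all 117 + 27 G-members of the `k = 2, 3` block-free sectors, one deeper exactly at the 5 + 2 B-members).  Beyond-print theorem: YES as a reduction (conditional
on the displays + GZK); the depth itself — Kolyvagin exactness at `2` — stays the crux.  BSD is not proved by any of this; C⁺ / crux 20509 stay OPEN; no class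
is closed by this file.

References: [cite: TianYuanZhang2017, §1 (arXiv:1411.4728 chunk p0002 L101–L110: `ρ(n)`, `φ_n : A_n → E_n`), §3.1 (p0011 L27–L36, L58–L66),
Prop. 3.2 (3) (p0010 L112), Thm. 3.5 (p0011 L94–L100), Lemma 3.18 (p0017 L152–L153)]; [cite: SilvermanTate2015, §3.4 Prop. 3.7, Prop. 3.8(b), §3.5 (the map α)];
[cite: SilvermanAEC2009, III.2.3(d), Prop. X.1.4, X.4.9]; [cite: Darmon2004, Thm. 3.22] (GZK, binder `hGZK`); [cite: Lang2002, VI §1 Thm. 1.2, Cor. 1.4];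
tree: `Literature/…/IsogenyTwoTorsionProofs` (`twoIsogenyFun`, `addX_self_mul`), `…/TwoIsogenyDualPoints` (`twoIsogenyDualFun_twoIsogenyFun'`),
`…/TwoIsogenyDescentAlpha` (`xSqClass`, `xSqClass_add`), `…/TwoIsogenySelmerGroupRankProofs` (`mem_range_twoIsogenyFun_of_xSqClass_eq_one`),
`TianYuanZhang2017/GenusDescentEnSide` (`stub_S0`, `stub_S1`, `stub_S3`, `ψQ`), this seat's `…GeneratorDepthRhoOne`, `…InvisibleGenerator` and g3/g16's
`…LevelTwoRhoValve`, `…VisibleGenerator`, `…LowerHalfVisibleSeven`; LEAD memo `Cruxes/RamifiedOffTYZOfFacts/Lines/offtyz_v7_GeneratorDepth.md` §7.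
-/

noncomputable section

open scoped Classical

open WeierstrassCurve WeierstrassCurve.Affine WeierstrassCurve.Affine.Point
  Literature.NumberTheory.EllipticCurves Literature.NumberTheory.EllipticCurves.Rank1Residual
  Summit.BirchSwinnertonDyer.Rank1Residual
  Literature.NumberTheory.EllipticCurves.TianYuanZhang2017
  Literature.NumberTheory.EllipticCurves.TianYuanZhang2017.W2
  Summit.BirchSwinnertonDyer.PrintCf2.GaloisMotion
  Summit.BirchSwinnertonDyer.Rank1Residual.P2.ThetaDescent
  Summit.BirchSwinnertonDyer.PrintCf2.LowerHalfVisible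
  Summit.BirchSwinnertonDyer.PrintCf2.VisibleGenerator

set_option autoImplicit false

namespace Summit.BirchSwinnertonDyer.PrintCf2.BlockFreeStructure

variable {n : ℕ}

/-! ## §2 THE BLOCK-FREE STRUCTURE THEOREM: C⁺ at `n` is decided by the descent class `d(h)` of the `A_n`-generator and the
`2`-adic depth of TYZ's point `P(n)` in `A(ℍ′_n)/tors` — `d(h) = 2`: depth exactly one; otherwise: depth zero -/

/-- `2s²` (`s ≠ 0`) is not a rational square. [folklore] -/
private theorem not_sq_of_two_mul_sq {X s : ℚ} (hs : s ≠ 0) (hX : X = 2 * s ^ 2) : ¬ ∃ q : ℚ, X = q ^ 2 := by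
  rintro ⟨q, hq⟩
  have h2 : IsSquare ((2 : ℕ) : ℚ) := ⟨q / s, by
    rw [div_mul_div_comm, ← pow_two, ← pow_two, ← hq, hX]; push_cast; field_simp⟩
  obtain ⟨m, hm⟩ := Rat.isSquare_natCast_iff.1 h2
  have hm2 : m ≤ 2 := by nlinarith
  interval_cases m <;> omega

/-- For odd `n`, no divisor is `≡ 6 (mod 8)`; with «no divisor `≡ 5 (mod 8)`» the family has NO block. [folklore] -/
private theorem noBlock_of_odd₃ (hodd : Odd n) (hnb : ∀ d ∈ n.divisors, d % 8 ≠ 5) :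
    ∀ d ∈ n.divisors, d % 8 ≠ 5 ∧ d % 8 ≠ 6 := by
  intro d hd
  refine ⟨hnb d hd, fun h6 => ?_⟩
  obtain ⟨k, hk⟩ := hodd.of_dvd_nat (Nat.dvd_of_mem_divisors hd)
  omega

/-- A generator of `A_n(ℚ)` modulo torsion has `X ≠ 0` when `rank E_n(ℚ) = 1` (`(0,0) = T̄` is torsion). [folklore] -/
private theorem X_ne_zero_of_generator (hsq : Squarefree n)
    (hrank : haveI := isElliptic_congruentNumberCurve hsq.ne_zero; (congruentNumberCurve n).mordellWeilRank = 1)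
    {X Y : ℚ} (h : (Atwo n).toAffine.Nonsingular X Y)
    (hgen : ∀ P : (Atwo n).toAffine.Point, ∃ m : ℤ, IsOfFinAddOrder (P - m • (Point.some X Y h : (Atwo n).toAffine.Point))) :
    X ≠ 0 := by
  haveI := isElliptic_congruentNumberCurve hsq.ne_zero
  intro hX0
  have hrank2 : 1 ≤ (Atwo n).mordellWeilRank := by
    rw [← (congruentNumberCurve n).twoIsogeny.mordellWeilRank_eq, hrank]
  obtain ⟨x₁, hx₁⟩ := LevelTwo.exists_not_isOfFinAddOrder_of_one_le_rank (Atwo n) hrank2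
  have hnt : ¬ IsOfFinAddOrder (Point.some X Y h : (Atwo n).toAffine.Point) :=
    LevelTwo.not_isOfFinAddOrder_of_generates hx₁ (hgen x₁)
  have hY : Y = 0 := by
    have := Atwo_equation h; rw [hX0] at this; nlinarith [sq_nonneg Y]
  apply hnt
  have e : (Point.some X Y h : (Atwo n).toAffine.Point) = (Atwo n).twoTorsionPoint := by
    subst hX0 hY; rfl
  rw [e]; convert isOfFinAddOrder_twoTorsionPoint (Atwo n) using 3; all_goals congr!

/-- **C⁺ ON THE STRATUM `d(h) = 2` (no `ρ`-hypothesis): `⟺ P(n) ∈ 2A(ℍ′_n) + tors ∧ P(n) ∉ 4A(ℍ′_n) + tors`.**  Square-free `n ≡ 7 (mod 8)` with no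
divisor `≡ 5 (mod 8)` (block-free); `ord_{s=1} L(E_n, s) = 1`; GZK; data `D` with `Printed` and `CMPointCompositumPrinted`; `h = (2s², Y)` a generator of
`A_n(ℚ)` modulo torsion.  (`ρ(n) = 0` by `rhoIndex_eq_one_of_X_not_sq`; then `InvisibleGenerator.levelTwo_iff_depth_genusPoint_eq_one_of_X_eq_two_mul_sq`.)
[cite: TianYuanZhang2017, §1 (p0002 L101–L110), §3.1 (p0011 L27–L36, L58–L66), Thm. 3.5 (p0011 L94–L100), Lemma 3.18 (p0017 L152–L153)] [cite: Darmon2004, Thm. 3.22] -/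
theorem levelTwo_iff_depth_eq_one_of_X_eq_two_mul_sq (hGZK : rank_eq_analyticRank_of_analyticRank_le_one)
    (hsq : Squarefree n) (h7 : n % 8 = 7) (hnb : ∀ d ∈ n.divisors, d % 8 ≠ 5)
    (hr : haveI := isElliptic_congruentNumberCurve hsq.ne_zero; (congruentNumberCurve n).analyticRank = 1)
    (D : GenusPointData n) (hPr : D.Printed) (hC : D.CMPointCompositumPrinted)
    {X Y : ℚ} (h : (Atwo n).toAffine.Nonsingular X Y) {s : ℚ} (hs : s ≠ 0) (hX : X = 2 * s ^ 2)
    (hgen : ∀ P : (Atwo n).toAffine.Point, ∃ m : ℤ, IsOfFinAddOrder (P - m • (Point.some X Y h : (Atwo n).toAffine.Point))) :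
    (∀ L : ℤ, IsScriptL n L → (2 : ℤ) ∣ L ∧ ¬ (4 : ℤ) ∣ L) ↔
      ((∃ y : APoint D.H, IsOfFinAddOrder (D.P n - (2 : ℤ) • y)) ∧
        ¬ ∃ y : APoint D.H, IsOfFinAddOrder (D.P n - (4 : ℤ) • y)) := by
  haveI := isElliptic_congruentNumberCurve hsq.ne_zero
  have hn1 : 1 < n := by omega
  have hrank : (congruentNumberCurve n).mordellWeilRank = 1 := (hGZK _ hr.le).1.trans hr
  have hρ : (rhoSubgroup n).index = 1 := rhoIndex_eq_one_of_X_not_sq hsq hn1 hrank h hgen (not_sq_of_two_mul_sq hs hX)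
  exact InvisibleGenerator.levelTwo_iff_depth_genusPoint_eq_one_of_X_eq_two_mul_sq hGZK hsq h7 hnb hr D hPr hC hρ h hs hX hgen

/-- **C⁺ OFF THE STRATUM `d(h) = 2` (no `ρ`-hypothesis): `⟺ P(n) ∉ 2A(ℍ′_n) + tors`.**  Same setting, `h = (X, Y)` a generator of `A_n(ℚ)` modulo
torsion with `X ∉ 2ℚ^{×2}`.  Two sub-cases, both landed: `X ∈ ℚ^{×2}` (`ρ(n) = 1` by `rhoIndex_eq_two_of_X_sq`;
`GeneratorDepth.levelTwo_iff_genusPoint_not_twoDivisible_of_rhoIndex_eq_two`) and `X ∉ ℚ² ∪ 2ℚ²` (the VISIBLE special stratum: `[α_n] ≠ 0` by g16's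
`VisibleGenerator.not_twoDivisible_of_sq_add_four`, then g3's `ρ`-free dichotomy `LevelTwoRhoValve.levelTwo_iff_genusPoint_not_twoDivisible`).
[cite: TianYuanZhang2017, §1 (p0002 L101–L110), §3.1 (p0011 L27–L36, L58–L66), Thm. 3.5 (p0011 L94–L100), Lemma 3.18 (p0017 L152–L153)] [cite: SilvermanAEC2009, Prop. X.1.4] [cite: Darmon2004, Thm. 3.22] -/
theorem levelTwo_iff_not_twoDivisible_of_X_ne_two_mul_sq (hGZK : rank_eq_analyticRank_of_analyticRank_le_one)
    (hsq : Squarefree n) (h7 : n % 8 = 7) (hnb : ∀ d ∈ n.divisors, d % 8 ≠ 5)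
    (hr : haveI := isElliptic_congruentNumberCurve hsq.ne_zero; (congruentNumberCurve n).analyticRank = 1)
    (D : GenusPointData n) (hPr : D.Printed) (hC : D.CMPointCompositumPrinted)
    {X Y : ℚ} (h : (Atwo n).toAffine.Nonsingular X Y) (hX : ¬ ∃ s : ℚ, X = 2 * s ^ 2)
    (hgen : ∀ P : (Atwo n).toAffine.Point, ∃ m : ℤ, IsOfFinAddOrder (P - m • (Point.some X Y h : (Atwo n).toAffine.Point))) :
    (∀ L : ℤ, IsScriptL n L → (2 : ℤ) ∣ L ∧ ¬ (4 : ℤ) ∣ L) ↔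
      ¬ ∃ y : APoint D.H, IsOfFinAddOrder (D.P n - (2 : ℤ) • y) := by
  haveI := isElliptic_congruentNumberCurve hsq.ne_zero
  have hn0 : n ≠ 0 := hsq.ne_zero
  have hodd : Odd n := Nat.odd_iff.mpr (by omega)
  have h8 : n % 8 = 5 ∨ n % 8 = 6 ∨ n % 8 = 7 := Or.inr (Or.inr h7)
  have hrank : (congruentNumberCurve n).mordellWeilRank = 1 := (hGZK _ hr.le).1.trans hr
  by_cases hXsq : ∃ q : ℚ, X = q ^ 2
  · have hρ2 : (rhoSubgroup n).index = 2 := rhoIndex_eq_two_of_X_sq hsq hrank h hgen hXsq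
    exact GeneratorDepth.levelTwo_iff_genusPoint_not_twoDivisible_of_rhoIndex_eq_two hGZK hsq h7 hnb hr D hPr hC hρ2
  · -- the visible special stratum
    have h35 : D.thm35Main := hPr.2.2.2.2.1
    have hLs : D.scriptLSpec := hPr.1
    have h318 : D.lemma318 := hPr.2.2.2.2.2.2.2.2.1
    obtain ⟨z, Φ, ΓH, ΓH', σ, θ, c, ρ₂, ρ₄, hconj, -, hcomp⟩ := hC
    have hcomm : ∀ g : D.H ≃ₐ[ℚ] D.H, g * c = c * g := fun g => hcomp.commute_of_noBlock (noBlock_of_odd₃ hodd hnb) g c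
    have hα : GeneratesFreePart n (ΘA hn0 (Point.some X Y h)) := generatesFreePart_ΘA hn0 _ hgen
    obtain ⟨Y', hP, hmap⟩ := exists_map_ΘA_eq_some hsq D h
    have hX12 : ¬ ∃ q : ℚ, X = q ^ 2 ∨ X = 2 * q ^ 2 := by
      rintro ⟨q, hq | hq⟩
      · exact hXsq ⟨q, hq⟩
      · exact hX ⟨q, hq⟩
    have hα2 : ¬ ∃ y : APoint D.H, IsOfFinAddOrder
        (Point.map (W' := curveA) (D.embK n (Nat.mem_divisors_self n hsq.ne_zero)) (ΘA hn0 (Point.some X Y h)) - (2 : ℤ) • y) := by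
      rw [hmap]
      exact not_twoDivisible_of_sq_add_four D hodd h318 c hconj.1 hconj.2.2 hcomm hP (not_sq_add_four_of_not_sq hn0 h hX12)
    exact LevelTwoRhoValve.levelTwo_iff_genusPoint_not_twoDivisible hGZK hsq h8 hr D h35 hLs hα hα2

/-- **THE BLOCK-FREE STRUCTURE THEOREM FOR C⁺.**  Square-free `n ≡ 7 (mod 8)` with no divisor `≡ 5 (mod 8)` (every prime `≡ ±1 (mod 8)`; `ℍ′_n = L_n(i)`);
`ord_{s=1} L(E_n, s) = 1`; GZK; data `D` with TYZ §3 as displayed (`Printed`) and the compositum sentence; `h = (X, Y)` ANY generator of `A_n(ℚ)` modulo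
torsion (`A_n : Y² = X³ + 4n²X`).  Then the conclusion of `stub_offTYZ_levelTwoScriptLExact` at `n` — `2 ∥ 𝓛(n)`, i.e. `BSD(E_n, 2)` on the jump-one
class — holds **iff the `2`-adic depth of TYZ's point `P(n)` in `A(ℍ′_n)/tors` equals `[X ∈ 2ℚ^{×2}]`**: `X = 2s²` and `P(n) ∈ 2A + tors ∧
P(n) ∉ 4A + tors`, or `X ∉ 2ℚ^{×2}` and `P(n) ∉ 2A + tors`.  (The generator side of C⁺ on the block-free family — `ρ(n)`, `[α_n]`, the depth of the
half of the Mordell–Weil generator — is COMPUTED by the lineage's theorems; what remains is the depth of `P(n)` alone.)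
[cite: TianYuanZhang2017, §1 (p0002 L101–L110), §3.1 (p0011 L27–L36, L58–L66), Prop. 3.2 (3) (p0010 L112), Thm. 3.5 (p0011 L94–L100), Lemma 3.18 (p0017 L152–L153)]
[cite: SilvermanAEC2009, Prop. X.1.4, X.4.9] [cite: Darmon2004, Thm. 3.22] [cite: Lang2002, VI §1 Thm. 1.2, Cor. 1.4] -/
theorem levelTwo_iff_depth_genusPoint_blockFree (hGZK : rank_eq_analyticRank_of_analyticRank_le_one)
    (hsq : Squarefree n) (h7 : n % 8 = 7) (hnb : ∀ d ∈ n.divisors, d % 8 ≠ 5)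
    (hr : haveI := isElliptic_congruentNumberCurve hsq.ne_zero; (congruentNumberCurve n).analyticRank = 1)
    (D : GenusPointData n) (hPr : D.Printed) (hC : D.CMPointCompositumPrinted)
    {X Y : ℚ} (h : (Atwo n).toAffine.Nonsingular X Y)
    (hgen : ∀ P : (Atwo n).toAffine.Point, ∃ m : ℤ, IsOfFinAddOrder (P - m • (Point.some X Y h : (Atwo n).toAffine.Point))) :
    (∀ L : ℤ, IsScriptL n L → (2 : ℤ) ∣ L ∧ ¬ (4 : ℤ) ∣ L) ↔
      (((∃ s : ℚ, X = 2 * s ^ 2) ∧ (∃ y : APoint D.H, IsOfFinAddOrder (D.P n - (2 : ℤ) • y)) ∧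
          ¬ ∃ y : APoint D.H, IsOfFinAddOrder (D.P n - (4 : ℤ) • y)) ∨
        ((¬ ∃ s : ℚ, X = 2 * s ^ 2) ∧ ¬ ∃ y : APoint D.H, IsOfFinAddOrder (D.P n - (2 : ℤ) • y))) := by
  haveI := isElliptic_congruentNumberCurve hsq.ne_zero
  have hrank : (congruentNumberCurve n).mordellWeilRank = 1 := (hGZK _ hr.le).1.trans hr
  by_cases hX : ∃ s : ℚ, X = 2 * s ^ 2
  · obtain ⟨s, hs⟩ := hX
    have hs0 : s ≠ 0 := by
      rintro rfl
      exact X_ne_zero_of_generator hsq hrank h hgen (by rw [hs]; ring)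
    rw [levelTwo_iff_depth_eq_one_of_X_eq_two_mul_sq hGZK hsq h7 hnb hr D hPr hC h hs0 hs hgen]
    constructor
    · intro hd; exact Or.inl ⟨⟨s, hs⟩, hd⟩
    · rintro (⟨-, hd⟩ | ⟨hno, -⟩)
      · exact hd
      · exact absurd ⟨s, hs⟩ hno
  · rw [levelTwo_iff_not_twoDivisible_of_X_ne_two_mul_sq hGZK hsq h7 hnb hr D hPr hC h hX hgen]
    constructor
    · intro hd; exact Or.inr ⟨hX, hd⟩
    · rintro (⟨hyes, -⟩ | ⟨-, hd⟩)
      · exact absurd hyes hX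
      · exact hd

end Summit.BirchSwinnertonDyer.PrintCf2.BlockFreeStructure

end
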